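import Mathlib
import HarnessLib
import Literature.MathematicalPhysics.KineticTheory.HardSphereEulerProofs
import Literature.Analysis.FluidPDE.HardSphereCollisionRecord
import Summits.AtomisticToContinuum.HydrodynamicLimit.Theorems.OneFlightGossipEngineKineticCurrentsWindowLDUniformKickFiltration
import Summits.AtomisticToContinuum.HydrodynamicLimit.Theorems.OneFlightGossipEngineKineticCurrentsWindowLDUniformLedgerAssemblyStatics
import Summits.AtomisticToContinuum.HydrodynamicLimit.Theorems.OneFlightGossipEngineKineticCurrentsWindowLDUniformLedgerAssemblyDuality

/-!
# Crux `KineticCurrentsWindowLDUniform` (stmt-AtomisticToContinuum-14662), line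
# `gossip-forecast-ledger`, stub `stub_qvCanonicalSummable` (S4d)

Under the local Gibbs law `μ = λ_N` (`σ ≤ 1/2`, a probability measure carried by the good set),
with `X = X_S` the window functional of a half `S` (window `w = τ (N+1)^{-1/3}`), `t_k` the group
kick times of `S` after `0` (junk `0` off the good set and past the last one),
`ℱ k = σ(z_S, (t_j, z_S(t_j))_{j<k})`, `d_k = μ[X | ℱ (k+1)] - μ[X | ℱ k]` and
`V_k = (2/α²) max(0, log μ[e^{α d_k} | ℱ k])`, the sequence `k ↦ V_k(z)` is a.e. summable, in
fact eventually `0`: on `B_k = {∃ j < k, t_j = 0 ∨ t_j ≥ w} ∈ ℱ k` every group collision of a good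
orbit in `(0, w]` is already revealed, so `X` agrees a.e. on `B_k` with an `ℱ k`-measurable
function (`CanonicalSummable.localization`, via the free-flight reconstruction
`KickFiltration.flow_eq_translate_sel`), hence `d_k = 0` and `V_k = 0` a.e. on `B_k` (pull-out
property, `CanonicalSummable.ae_max_log_condExp_eq_zero`); and a good orbit lies in `B_k` for all
large `k`, its collision times being locally finite. References: Gallagher–Saint-Raymond–Texier,
*From Newton to Boltzmann* (2013), §4.1; Williams, *Probability with Martingales* (1991), §9.7.
-/
noncomputable section

open MeasureTheory Set Filter InformationTheory
open scoped ENNReal Topology Classical ProbabilityTheory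

namespace Summit.AtomisticToContinuum.HydrodynamicLimit.Theorems.KineticCurrentsWindowLDUniformGossip

open Literature.Analysis.FluidPDE (HardSphereFlow Config localMaxwellian collisionTimesOf nthTimeAfter)
open Literature.MathematicalPhysics.KineticTheory (T3 V3 hsDiameter localGibbsLaw)

namespace CanonicalSummable

open Literature.Analysis.FluidPDE

section Generic

variable {Ω : Type*} {m m₂ mΩ : MeasurableSpace Ω} {P : Measure Ω} [IsFiniteMeasure P]

/-- **Localisation of a forecast** (pull-out property): if `B ∈ m` and the integrable `X` agrees
a.e. on `B` with an `m`-measurable `Y`, then `P[X | m] = Y` a.e. on `B`. [folklore] -/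
theorem ae_condExp_eq_of_eqOn (hm : m ≤ mΩ) {X Y : Ω → ℝ} {B : Set Ω}
    (hB : MeasurableSet[m] B) (hX : Integrable X P) (hY : StronglyMeasurable[m] Y)
    (hXY : ∀ᵐ ω ∂P, ω ∈ B → X ω = Y ω) : ∀ᵐ ω ∂P, ω ∈ B → (P[X|m]) ω = Y ω := by
  have hind : B.indicator X =ᵐ[P] B.indicator Y := by
    filter_upwards [hXY] with ω hω
    by_cases hω' : ω ∈ B
    · rw [indicator_of_mem hω', indicator_of_mem hω', hω hω']
    · rw [indicator_of_notMem hω', indicator_of_notMem hω']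
  have hYint : Integrable (B.indicator Y) P := (hX.indicator (hm B hB)).congr hind
  have h2 : P[B.indicator X|m] =ᵐ[P] B.indicator Y := (condExp_congr_ae hind).trans
    (condExp_of_stronglyMeasurable hm (hY.indicator hB) hYint).eventuallyEq
  filter_upwards [condExp_indicator hX hB, h2] with ω h1 h2 hω
  simpa only [indicator_of_mem hω] using h1.symm.trans h2

/-- **The canonical proxy vanishes where the functional is revealed**: if `m ≤ m₂`, `B ∈ m` and
the integrable `X` agrees a.e. on `B` with an `m`-measurable `Y`, then a.e. on `B` the increment
`P[X|m₂] - P[X|m]` vanishes and `max(0, log P[e^{α(P[X|m₂] - P[X|m])} | m]) = 0`. [folklore] -/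
theorem ae_max_log_condExp_eq_zero (hm : m ≤ mΩ) (hm₂ : m₂ ≤ mΩ) (hmm : m ≤ m₂) {X Y : Ω → ℝ}
    {B : Set Ω} (hB : MeasurableSet[m] B) (hX : Integrable X P) (hY : StronglyMeasurable[m] Y)
    (hXY : ∀ᵐ ω ∂P, ω ∈ B → X ω = Y ω) (α : ℝ) :
    ∀ᵐ ω ∂P, ω ∈ B →
      max 0 (Real.log ((P[fun ω => Real.exp (α * ((P[X|m₂]) ω - (P[X|m]) ω))|m]) ω)) = 0 := by
  have hk₁ := ae_condExp_eq_of_eqOn hm hB hX hY hXY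
  have hk₂ := ae_condExp_eq_of_eqOn hm₂ (hmm B hB) hX (hY.mono hmm) hXY
  set G : Ω → ℝ := fun ω => Real.exp (α * ((P[X|m₂]) ω - (P[X|m]) ω)) with hGdef
  by_cases hG : Integrable G P
  swap
  · refine ae_of_all _ fun ω _ => ?_
    rw [condExp_of_not_integrable hG, Pi.zero_apply, Real.log_zero, max_self]
  have hGind : B.indicator G =ᵐ[P] B.indicator fun _ => (1 : ℝ) := by
    filter_upwards [hk₁, hk₂] with ω h1 h2
    by_cases hω : ω ∈ B
    · simp only [indicator_of_mem hω, hGdef, h1 hω, h2 hω, sub_self, mul_zero, Real.exp_zero]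
    · rw [indicator_of_notMem hω, indicator_of_notMem hω]
  have h2 : P[B.indicator G|m] =ᵐ[P] B.indicator fun _ => (1 : ℝ) :=
    (condExp_congr_ae hGind).trans
      (condExp_of_stronglyMeasurable hm (stronglyMeasurable_const.indicator hB)
        ((integrable_const (1 : ℝ)).indicator (hm B hB))).eventuallyEq
  filter_upwards [condExp_indicator hG hB, h2] with ω h1 h2 hω
  rw [show (P[G|m]) ω = 1 by simpa only [indicator_of_mem hω] using h1.symm.trans h2,
    Real.log_one, max_self]

end Generic

/-- A nonzero next time after `x` is a genuine element of the set after `x`. [folklore] -/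
theorem nextTimeAfter_mem_of_ne_zero {A : Set ℝ} {x : ℝ} (hfin : ∀ b, (A ∩ Ioc x b).Finite)
    (h : nextTimeAfter A x ≠ 0) : nextTimeAfter A x ∈ A ∧ x < nextTimeAfter A x := by
  have hne : (A ∩ Ioi x).Nonempty := by
    by_contra h'
    exact h (nextTimeAfter_of_eq_empty (not_nonempty_iff_eq_empty.1 h'))
  exact (isLeast_nextTimeAfter hfin hne).1

/-- **Tail dichotomy**: for a set finite on bounded intervals, some enumerated time after `0` is
the junk `0` or is `≥ w` (else the enumeration increases strictly inside `A ∩ (0, w]`). [folklore] -/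
theorem exists_nthTimeAfter_eq_zero_or_le {A : Set ℝ} (hfin : ∀ a b, (A ∩ Ioc a b).Finite)
    (w : ℝ) :
    ∃ j, nthTimeAfter A 0 j = 0 ∨ w ≤ nthTimeAfter A 0 j := by
  by_contra h
  push Not at h
  have h0 : nthTimeAfter A 0 0 ∈ A ∧ 0 < nthTimeAfter A 0 0 :=
    nextTimeAfter_mem_of_ne_zero (hfin 0) (h 0).1
  have hstep : ∀ j, nthTimeAfter A 0 (j + 1) ∈ A ∧
      nthTimeAfter A 0 j < nthTimeAfter A 0 (j + 1) := by
    intro j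
    rw [nthTimeAfter_succ]
    exact nextTimeAfter_mem_of_ne_zero (hfin _) (by rw [← nthTimeAfter_succ]; exact (h (j + 1)).1)
  have hmono : StrictMono (nthTimeAfter A 0) := strictMono_nat_of_lt_succ fun j => (hstep j).2
  have hmem : ∀ j, nthTimeAfter A 0 j ∈ A ∩ Ioc 0 w := fun j =>
    ⟨Nat.rec h0.1 (fun j _ => (hstep j).1) j, h0.2.trans_le (hmono.monotone (Nat.zero_le j)),
      (h j).2.le⟩
  exact infinite_of_injective_forall_mem hmono.injective hmem (hfin 0 w)

/-- **The window is revealed before `k`**: if some enumerated time of index `j < k` is the junk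
`0` or is `≥ w`, every `s ∈ A ∩ (0, w]` is an enumerated time of index `< k`. [folklore] -/
theorem exists_lt_nthTimeAfter_eq {A : Set ℝ} (hfin : ∀ a b, (A ∩ Ioc a b).Finite) {w s : ℝ}
    (hs : s ∈ A) (h0s : 0 < s) (hsw : s ≤ w) {j k : ℕ} (hjk : j < k)
    (hj : nthTimeAfter A 0 j = 0 ∨ w ≤ nthTimeAfter A 0 j) : ∃ n < k, nthTimeAfter A 0 n = s := by
  obtain ⟨m, hm, hmem, -, -⟩ := nthTimeAfter_enum hfin hs h0s
  by_cases hmk : m < k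
  · exact ⟨m, hmk, hm⟩
  · have hj' := hmem j (hjk.le.trans (not_lt.1 hmk))
    rcases hj with h | h
    · exact absurd hj'.2.1 (by rw [h]; exact lt_irrefl 0)
    · exact ⟨j, hjk, le_antisymm hj'.2.2 (hsw.trans h)⟩

/-- **The last-slot selection only reads the revealed times**: for `(L, sel)` as in
`KickFiltration.exists_lastSelection`, two slot sequences (same time `r`, same initial state) whose
slot times in `(0, r]` form the same finite set and whose slots with time in `(0, r]` carry the
state `φ(time)` for one `φ` give the same selected time and state. [folklore] -/
theorem lastSelection_congr {Y : Type*} {L : (Y × (ℕ → ℝ × Y)) × ℝ → ℝ}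
    {sel : (Y × (ℕ → ℝ × Y)) × ℝ → Y}
    (hLs : ∀ p : (Y × (ℕ → ℝ × Y)) × ℝ,
      {x : ℝ | ∃ k, (0 < (p.1.2 k).1 ∧ (p.1.2 k).1 ≤ p.2) ∧ (p.1.2 k).1 = x}.Finite →
      (∀ k, 0 < (p.1.2 k).1 → (p.1.2 k).1 ≤ p.2 → (p.1.2 k).1 ≤ L p) ∧
      ((L p = 0 ∧ sel p = p.1.1) ∨ ∃ k,
        (0 < (p.1.2 k).1 ∧ (p.1.2 k).1 ≤ p.2) ∧ (p.1.2 k).1 = L p ∧ sel p = (p.1.2 k).2))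
    {y₀ : Y} {t t' : ℕ → ℝ} {ψ ψ' : ℕ → Y} {r : ℝ}
    (hfin : {x : ℝ | ∃ k, (0 < t k ∧ t k ≤ r) ∧ t k = x}.Finite)
    (hset : ∀ x, 0 < x → x ≤ r → ((∃ k, t k = x) ↔ ∃ k, t' k = x))
    (φ : ℝ → Y) (hφ : ∀ k, 0 < t k → t k ≤ r → ψ k = φ (t k))
    (hφ' : ∀ k, 0 < t' k → t' k ≤ r → ψ' k = φ (t' k)) :
    L ((y₀, fun k => (t k, ψ k)), r) = L ((y₀, fun k => (t' k, ψ' k)), r) ∧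
      sel ((y₀, fun k => (t k, ψ k)), r) = sel ((y₀, fun k => (t' k, ψ' k)), r) := by
  have hfin' : {x : ℝ | ∃ k, (0 < t' k ∧ t' k ≤ r) ∧ t' k = x}.Finite := by
    refine hfin.subset fun x ⟨k, hk, hx⟩ => ?_
    obtain ⟨k₀, hk₀⟩ := (hset _ hk.1 hk.2).2 ⟨k, rfl⟩
    exact ⟨k₀, by rw [hk₀]; exact hk, hk₀.trans hx⟩
  obtain ⟨hdom, hsel⟩ := hLs ((y₀, fun k => (t k, ψ k)), r) hfin
  obtain ⟨hdom', hsel'⟩ := hLs ((y₀, fun k => (t' k, ψ' k)), r) hfin'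
  dsimp only at hdom hsel hdom' hsel'
  rcases hsel with ⟨h0, hy⟩ | ⟨k, hk, hkL, hy⟩
  · -- no revealed time in `(0, r]` for either sequence
    have hnone : ∀ k, ¬ (0 < t' k ∧ t' k ≤ r) := by
      intro k hk
      obtain ⟨k₀, hk₀⟩ := (hset _ hk.1 hk.2).2 ⟨k, rfl⟩
      have h := hdom k₀ (by rw [hk₀]; exact hk.1) (by rw [hk₀]; exact hk.2)
      rw [hk₀, h0] at h
      exact (not_lt.2 h) hk.1
    rcases hsel' with ⟨h0', hy'⟩ | ⟨k', hk', -, -⟩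
    · exact ⟨h0.trans h0'.symm, hy.trans hy'.symm⟩
    · exact absurd hk' (hnone k')
  · -- the last revealed time is positive and is a slot time of both sequences
    have hLpos : 0 < L ((y₀, fun k => (t k, ψ k)), r) := by rw [← hkL]; exact hk.1
    obtain ⟨k₁, hk₁⟩ := (hset _ hk.1 hk.2).1 ⟨k, rfl⟩
    have h1 : L ((y₀, fun k => (t k, ψ k)), r) ≤ L ((y₀, fun k => (t' k, ψ' k)), r) := by
      have h := hdom' k₁ (by rw [hk₁]; exact hk.1) (by rw [hk₁]; exact hk.2)
      rwa [hk₁, hkL] at h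
    rcases hsel' with ⟨h0', -⟩ | ⟨k', hk', hk'L, hy'⟩
    · exact absurd (hLpos.trans_le h1) (by rw [h0']; exact lt_irrefl 0)
    · obtain ⟨k₂, hk₂⟩ := (hset _ hk'.1 hk'.2).2 ⟨k', rfl⟩
      have h2 : L ((y₀, fun k => (t' k, ψ' k)), r) ≤ L ((y₀, fun k => (t k, ψ k)), r) := by
        have h := hdom k₂ (by rw [hk₂]; exact hk'.1) (by rw [hk₂]; exact hk'.2)
        rwa [hk₂, hk'L] at h
      refine ⟨le_antisymm h1 h2, ?_⟩
      rw [hy, hy', hφ k hk.1 hk.2, hφ' k' hk'.1 hk'.2, hkL, hk'L, le_antisymm h1 h2]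

variable {N : ℕ} {ε : ℝ}

/-- The group collision times of a good orbit are finite on bounded intervals. [folklore] -/
theorem finite_groupTimes_inter_Ioc (Φ : HardSphereFlow (Torus.geometry (Fin 3)) ε N)
    (S : Finset (Fin N)) {z : Config N (Fin 3) T3} (hz : z ∈ Φ.good) (a b : ℝ) :
    ((⋃ i ∈ S, collisionTimesOf (Torus.geometry (Fin 3)) ε (fun s => Φ.flow s z) i) ∩
      Ioc a b).Finite :=
  ((Φ.isTrajectory z hz).finite_collisionTimes_inter_of_subset_Icc Ioc_subset_Icc_self).subset
    (inter_subset_inter_left _ (iUnion₂_subset fun i _ => collisionTimesOf_subset _ i))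

/-- **Localisation of the window functional.** With `t_k` the group kick times of `S` and
`ℱ n = σ(z_S, (t_k, (Φ_{t_k} z)_S)_{k<n})`: `B_k = {z | ∃ j < k, t_j z = 0 ∨ w ≤ t_j z} ∈ ℱ k`, and
some `ℱ k`-measurable `Y` equals `Σ_{i∈S} w⁻¹ ∫₀ʷ F((Φ_r z)_i) dr` at every good `z ∈ B_k` (there
every group collision time in `(0, w]` is a revealed `t_j, j < k`, so the free-flight reconstruction
`KickFiltration.flow_eq_translate_sel` ignores the slots of index `≥ k`). [folklore] -/
theorem localization (Φ : HardSphereFlow (Torus.geometry (Fin 3)) ε N) {F : T3 × V3 → ℝ}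
    (hF : Continuous F) {w : ℝ} (hw : 0 ≤ w) (S : Finset (Fin N))
    {tk : ℕ → Config N (Fin 3) T3 → ℝ}
    (htk : ∀ k, ∀ z ∈ Φ.good, tk k z = nthTimeAfter
      (⋃ i ∈ S, collisionTimesOf (Torus.geometry (Fin 3)) ε (fun s => Φ.flow s z) i) 0 k)
    {ℱ : ℕ → MeasurableSpace (Config N (Fin 3) T3)}
    (hℱ : ∀ n, ℱ n =
      MeasurableSpace.comap (fun (z : Config N (Fin 3) T3) (i : S) => z i.1) inferInstance ⊔
        ⨆ k < n, MeasurableSpace.comap (fun (z : Config N (Fin 3) T3) =>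
          (tk k z, fun i : S => Φ.flow (tk k z) z i.1)) inferInstance) (k : ℕ) :
    MeasurableSet[ℱ k] {z | ∃ j < k, tk j z = 0 ∨ w ≤ tk j z} ∧
      ∃ Y : Config N (Fin 3) T3 → ℝ, StronglyMeasurable[ℱ k] Y ∧
        ∀ z ∈ Φ.good, (∃ j < k, tk j z = 0 ∨ w ≤ tk j z) →
          ∑ i ∈ S, w⁻¹ * ∫ r in (0 : ℝ)..w, F ((Φ.flow r z) i) = Y z := by
  -- (a) the revealed coordinates of index `< k` are `ℱ k`-measurable; `B_k ∈ ℱ k`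
  have hπ : Measurable[ℱ k] fun (z : Config N (Fin 3) T3) (i : S) => z i.1 :=
    (comap_measurable _).mono (by rw [hℱ k]; exact le_sup_left) le_rfl
  have hρ : ∀ j < k, Measurable[ℱ k] fun z => (tk j z, fun i : S => Φ.flow (tk j z) z i.1) := by
    intro j hj
    refine (comap_measurable _).mono ?_ le_rfl
    rw [hℱ k]
    exact le_trans (le_iSup₂_of_le (f := fun k' (_ : k' < k) => MeasurableSpace.comap
      (fun (z : Config N (Fin 3) T3) => (tk k' z, fun i : S => Φ.flow (tk k' z) z i.1))
        inferInstance) j hj le_rfl) le_sup_right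
  have htkm : ∀ j < k, Measurable[ℱ k] (tk j) := fun j hj => (hρ j hj).fst
  refine ⟨?_, ?_⟩
  · have hB : {z | ∃ j < k, tk j z = 0 ∨ w ≤ tk j z} =
        ⋃ j ∈ Finset.range k, ({z | tk j z = 0} ∪ {z | w ≤ tk j z}) := by
      ext z
      simp only [mem_setOf_eq, mem_iUnion, Finset.mem_range, mem_union, exists_prop]
    rw [hB]
    exact Finset.measurableSet_biUnion _ fun j hj =>
      (measurableSet_eq_fun (htkm j (Finset.mem_range.1 hj)) measurable_const).union
        (measurableSet_le measurable_const (htkm j (Finset.mem_range.1 hj)))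
  -- (b) the Borel functional of the revealed data (as in `KickFiltration.main`)
  obtain ⟨L, sel, hLm, hselm, hLs⟩ := KickFiltration.exists_lastSelection (↥S → T3 × V3)
  set R : ((↥S → T3 × V3) × (ℕ → ℝ × (↥S → T3 × V3))) × ℝ → ↥S → T3 × V3 := fun q i =>
    ((Torus.geometry (Fin 3)).translate (sel q i).1 ((q.2 - L q) • (sel q i).2), (sel q i).2)
    with hRdef
  have hRm : ∀ i, Measurable fun q => R q i := fun i => by
    have hc : Continuous fun q : (T3 × V3) × ℝ =>
        ((Torus.geometry (Fin 3)).translate q.1.1 (q.2 • q.1.2), q.1.2) := by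
      simp only [Torus.geometry_translate]
      exact (continuous_fst.fst.add (Literature.Analysis.FunctionSpaces.Torus.continuous_proj.comp
        (continuous_snd.smul continuous_fst.snd))).prodMk continuous_fst.snd
    exact hc.measurable.comp
      (((measurable_pi_apply i).comp hselm).prodMk (measurable_snd.sub hLm))
  set H : (↥S → T3 × V3) × (ℕ → ℝ × (↥S → T3 × V3)) → ℝ := fun ω =>
    ∑ i : S, w⁻¹ * ∫ r in (0 : ℝ)..w, F (R (ω, r) i) with hHdef
  have hH : Measurable H := by
    refine Finset.measurable_sum _ fun i _ => Measurable.const_mul ?_ _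
    have hint : StronglyMeasurable
        fun q : ((↥S → T3 × V3) × (ℕ → ℝ × (↥S → T3 × V3))) × ℝ => F (R q i) :=
      (hF.measurable.comp (hRm i)).stronglyMeasurable
    have h1 := (hint.integral_prod_right' (ν := volume.restrict (Ioc 0 w))).measurable
    have h2 := (hint.integral_prod_right' (ν := volume.restrict (Ioc w 0))).measurable
    simp only [intervalIntegral]
    exact h1.sub h2
  -- (c) the revealed data truncated at index `k`: an `ℱ k`-measurable map
  set revT : Config N (Fin 3) T3 → (↥S → T3 × V3) × (ℕ → ℝ × (↥S → T3 × V3)) := fun z =>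
    (fun i : S => z i.1, fun j => (if j < k then tk j z else 0,
      if j < k then (fun i : S => Φ.flow (tk j z) z i.1) else fun i : S => z i.1))
    with hrevTdef
  have hrevT : Measurable[ℱ k] revT := by
    letI : MeasurableSpace (Config N (Fin 3) T3) := ℱ k
    rw [hrevTdef]
    refine hπ.prodMk (measurable_pi_lambda _ fun j => ?_)
    by_cases hj : j < k
    · simp only [if_pos hj]
      exact hρ j hj
    · simp only [if_neg hj]
      exact measurable_const.prodMk hπ
  refine ⟨fun z => H (revT z), (hH.comp hrevT).stronglyMeasurable, fun z hz hBz => ?_⟩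
  -- (d) a good orbit whose revealed collisions cover the window
  set T : Set ℝ := ⋃ i ∈ S, collisionTimesOf (Torus.geometry (Fin 3)) ε (fun s => Φ.flow s z) i
    with hTdef
  have hTfin : ∀ a b, (T ∩ Ioc a b).Finite := fun a b => finite_groupTimes_inter_Ioc Φ S hz a b
  have htkT : ∀ j, tk j z ∈ T ∨ tk j z = 0 := fun j => by
    rw [htk j z hz, nthTimeAfter, Function.iterate_succ_apply']
    by_cases hne : (T ∩ Ioi ((nextTimeAfter T)^[j] 0)).Nonempty
    · exact Or.inl (nextTimeAfter_mem (hTfin _) hne)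
    · exact Or.inr (nextTimeAfter_of_eq_empty (not_nonempty_iff_eq_empty.1 hne))
  obtain ⟨j₀, hj₀k, hj₀⟩ := hBz
  rw [htk j₀ z hz] at hj₀
  have hcov : ∀ s ∈ T, 0 < s → s ≤ w → ∃ n < k, tk n z = s := fun s hs h0s hsw => by
    obtain ⟨n, hn, he⟩ := exists_lt_nthTimeAfter_eq hTfin hs h0s hsw hj₀k hj₀
    exact ⟨n, hn, by rw [htk n z hz]; exact he⟩
  -- the selection fed with the full and with the truncated data agree on `[0, w]`
  have hLsel : ∀ r, 0 ≤ r → r ≤ w →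
      L ((fun i : S => z i.1, fun j => (tk j z, fun i : S => Φ.flow (tk j z) z i.1)), r) =
          L (revT z, r) ∧
        sel ((fun i : S => z i.1, fun j => (tk j z, fun i : S => Φ.flow (tk j z) z i.1)), r) =
          sel (revT z, r) := by
    intro r _ hrw
    simp only [hrevTdef]
    refine lastSelection_congr hLs ?_ ?_ (fun t => fun i : S => Φ.flow t z i.1) ?_ ?_
    · refine (hTfin 0 r).subset ?_
      rintro x ⟨j, ⟨h1, h2⟩, rfl⟩
      exact ⟨(htkT j).resolve_right h1.ne', h1, h2⟩
    · intro x h0x hxr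
      constructor
      · rintro ⟨j, rfl⟩
        obtain ⟨n, hn, he⟩ := hcov _ ((htkT j).resolve_right h0x.ne') h0x (hxr.trans hrw)
        exact ⟨n, by rw [if_pos hn]; exact he⟩
      · rintro ⟨j, hj⟩
        by_cases hjk : j < k
        · exact ⟨j, by rwa [if_pos hjk] at hj⟩
        · exact absurd h0x (by rw [← hj, if_neg hjk]; exact lt_irrefl 0)
    · exact fun j _ _ => rfl
    · intro j h1 _
      by_cases hjk : j < k
      · simp only [if_pos hjk]
      · simp only [if_neg hjk, lt_self_iff_false] at h1
  -- (e) conclusion: the window integrals only see the reconstruction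
  simp only [hHdef]
  rw [← Finset.sum_coe_sort S]
  refine Finset.sum_congr rfl fun i _ => ?_
  congr 1
  refine intervalIntegral.integral_congr fun r hr => ?_
  rw [uIcc_of_le hw] at hr
  rw [KickFiltration.flow_eq_translate_sel Φ S hz (fun k => htk k z hz) hr.1 (hLs _) rfl i]
  obtain ⟨hL, hs⟩ := hLsel r hr.1 hr.2
  simp only [hRdef, hL, hs]

end CanonicalSummable

/-- S4d — under the local Gibbs law the canonical predictable proxy of the forecast martingale of a half's window functional is a.e. summable (it vanishes a.e. once the revealed group collision times cover the window) (registered stub `stub_qvCanonicalSummable` of line `gossip-forecast-ledger`, crux stmt-AtomisticToContinuum-14662). [folklore] -/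
theorem stub_qvCanonicalSummable :
    ∀ (a θ₀ : T3 → ℝ) (u₀ : T3 → V3), Continuous a → Continuous θ₀ → Continuous u₀ →
      (∀ x, 0 < a x) → (∀ x, 0 < θ₀ x) → ∀ σ : ℝ, 0 < σ → σ ≤ 1 / 2 → ∀ N : ℕ,
      ∀ Φ : HardSphereFlow (Literature.Analysis.FluidPDE.Torus.geometry (Fin 3)) (hsDiameter σ N) (N + 1),
      ∀ (F : T3 × V3 → ℝ), Continuous F → ∀ C : ℝ, (∀ y, |F y| ≤ C * (1 + ‖y.2‖ ^ 2)) →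
      ∀ α : ℝ, 0 < α → α * (16 * max C 1 * ⨆ x, θ₀ x) ≤ 1 → ∀ τ : ℝ, 0 < τ →
      ∀ S : Finset (Fin (N + 1)),
      let μ : Measure (Config (N + 1) (Fin 3) T3) := localGibbsLaw σ a u₀ θ₀ N Φ
      let X : Config (N + 1) (Fin 3) T3 → ℝ := fun z => ∑ i ∈ S, (τ * ((N : ℝ) + 1) ^ (-(1 / 3 : ℝ)))⁻¹ * ∫ r in (0 : ℝ)..(τ * ((N : ℝ) + 1) ^ (-(1 / 3 : ℝ))), F ((Φ.flow r z) i)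
      let T : Config (N + 1) (Fin 3) T3 → Set ℝ := fun z =>
        ⋃ i ∈ S, collisionTimesOf (Literature.Analysis.FluidPDE.Torus.geometry (Fin 3)) (hsDiameter σ N) (fun t => Φ.flow t z) i
      let tk : ℕ → Config (N + 1) (Fin 3) T3 → ℝ := fun k z => if z ∈ Φ.good then nthTimeAfter (T z) 0 k else 0
      let ℱ : ℕ → MeasurableSpace (Config (N + 1) (Fin 3) T3) := fun n =>
        MeasurableSpace.comap (fun (z : Config (N + 1) (Fin 3) T3) (i : S) => z i.1) inferInstance ⊔
          ⨆ k < n, MeasurableSpace.comap (fun (z : Config (N + 1) (Fin 3) T3) => (tk k z, fun i : S => Φ.flow (tk k z) z i.1))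
            inferInstance
      let V : ℕ → Config (N + 1) (Fin 3) T3 → ℝ := fun k z =>
        2 / α ^ 2 * max 0 (Real.log ((μ[fun z => Real.exp (α * ((μ[X|ℱ (k + 1)]) z - (μ[X|ℱ k]) z))|ℱ k]) z))
      ∀ᵐ z ∂μ, Summable (fun k => V k z) := by
  intro a θ₀ u₀ ha hθ hu ha0 hθ0 σ hσ hσ2 N Φ F hFc C hC α _hα _hαle τ hτ S μ X T tk ℱ V
  -- (1) the filtration is Borel, `X` is a.e. strongly measurable (S1); the law is a probability
  -- measure carried by the good set; `X ∈ L¹` by the static exponential moment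
  have hKF := stub_kickFiltration σ hσ a θ₀ u₀ N Φ F hFc τ hτ S
  have hle : ∀ n, ℱ n ≤ (inferInstance : MeasurableSpace (Config (N + 1) (Fin 3) T3)) := hKF.1
  have hXm : AEStronglyMeasurable X μ := hKF.2.mono (iSup_le hle)
  haveI := Literature.MathematicalPhysics.KineticTheory.isProbabilityMeasure_localGibbsLaw
    ha hθ hu ha0 hθ0 hσ2 N Φ
  have hμgood : μ Φ.goodᶜ = 0 := by
    show localGibbsLaw σ a u₀ θ₀ N Φ Φ.goodᶜ = 0
    rw [Literature.MathematicalPhysics.KineticTheory.localGibbsLaw_eq]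
    exact Literature.MathematicalPhysics.KineticTheory.localGibbsMeasure_absolutelyContinuous
      σ a u₀ θ₀ N Φ Φ.measure_compl_good
  have hae : ∀ᵐ z ∂μ, z ∈ Φ.good := mem_ae_iff.2 hμgood
  have hw : 0 < τ * ((N : ℝ) + 1) ^ (-(1 / 3 : ℝ)) :=
    mul_pos hτ (Real.rpow_pos_of_pos (by positivity) _)
  obtain ⟨c₀, hc₀, hstat⟩ := LedgerAssembly.static_expMoment ha hθ hu ha0 hθ0 hσ hσ2 hFc hC
  have hexp : Integrable (fun z => Real.exp (c₀ * |X z|)) μ := by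
    have hm : AEStronglyMeasurable (fun z => Real.exp (c₀ * |X z|)) μ :=
      (by fun_prop : Continuous fun x : ℝ => Real.exp (c₀ * |x|)).comp_aestronglyMeasurable hXm
    exact (lintegral_ofReal_ne_top_iff_integrable hm
      (ae_of_all _ fun _ => (Real.exp_pos _).le)).1 (hstat c₀ hc₀.le le_rfl N Φ S _ hw)
  have hXint : Integrable X μ := by
    refine (hexp.div_const c₀).mono' hXm (ae_of_all _ fun z => ?_)
    rw [Real.norm_eq_abs, le_div_iff₀ hc₀]
    nlinarith [Real.add_one_le_exp (c₀ * |X z|), abs_nonneg (X z)]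
  -- (2) localisation: `V k = 0` a.e. on `B_k = {∃ j < k, t_j = 0 ∨ t_j ≥ w}`
  have hmono : ∀ k, ℱ k ≤ ℱ (k + 1) := fun k =>
    sup_le_sup_left (biSup_mono fun j hj => Nat.lt_succ_of_lt hj) _
  have hloc : ∀ k, ∀ᵐ z ∂μ,
      (∃ j < k, tk j z = 0 ∨ τ * ((N : ℝ) + 1) ^ (-(1 / 3 : ℝ)) ≤ tk j z) → V k z = 0 := by
    intro k
    obtain ⟨hB, Y, hY, hXY⟩ := CanonicalSummable.localization Φ hFc hw.le S (tk := tk)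
      (fun k z hz => if_pos hz) (ℱ := ℱ) (fun n => rfl) k
    filter_upwards [CanonicalSummable.ae_max_log_condExp_eq_zero (hle k) (hle (k + 1)) (hmono k)
      hB hXint hY (hae.mono fun z hz hBz => hXY z hz hBz) α] with z hz hBz
    exact mul_eq_zero_of_right _ (hz hBz)
  -- (3) tail: a good orbit lies in `B_k` for all large `k`, so `V k z = 0` eventually
  filter_upwards [ae_all_iff.2 hloc, hae] with z hz hzg
  have hTfin : ∀ a' b, (T z ∩ Ioc a' b).Finite := fun a' b =>
    CanonicalSummable.finite_groupTimes_inter_Ioc Φ S hzg a' b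
  obtain ⟨j, hj⟩ := CanonicalSummable.exists_nthTimeAfter_eq_zero_or_le hTfin
    (τ * ((N : ℝ) + 1) ^ (-(1 / 3 : ℝ)))
  have hj' : tk j z = 0 ∨ τ * ((N : ℝ) + 1) ^ (-(1 / 3 : ℝ)) ≤ tk j z := by
    rwa [← show tk j z = nthTimeAfter (T z) 0 j from if_pos hzg] at hj
  refine summable_of_ne_finset_zero (s := Finset.range (j + 1)) fun k hk => ?_
  rw [Finset.mem_range, not_lt] at hk
  exact hz k ⟨j, Nat.lt_of_succ_le hk, hj'⟩

end Summit.AtomisticToContinuum.HydrodynamicLimit.Theorems.KineticCurrentsWindowLDUniformGossip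

end
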